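import Mathlib.RepresentationTheory.Semisimple
import Literature.RepresentationTheory.FiniteGroups.EquivOfCharacter
import HarnessLib

/-!
# Subrepresentations and equivalences: the `k[G]`-module dictionary

Topic `Literature/RepresentationTheory/Semisimple` (glue used by `Twist`, `Multiplicity`,
`MultiplicityDecomposition` and, downstream, by the discharge of Harris–Lan–Taylor–Thorne's
Prop. 7.12 in `Literature/NumberTheory/GaloisRepresentations/TwistedSumAlgebraic`).
Everything is standard (Curtis–Reiner, *Methods of Representation Theory* I, §3; Bourbaki,
*Algèbre* VIII § 4) and fully proved; it complements the tree's
`Literature/RepresentationTheory/FiniteGroups/EquivOfCharacter` (which provides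
`Subrepresentation.prodEquivOfIsCompl`, `Subrepresentation.equivRange`,
`Subrepresentation.subtypeIntertwiningMap`, `Representation.Equiv.prodCongr`,
`Representation.exists_ne_bot_isIrreducible`; they are imported, not restated).

Mathlib describes irreducibility and semisimplicity of `ρ : Representation k G V` through the
`k[G]`-module `ρ.asModule` (`Representation.irreducible_iff_isSimpleModule_asModule`,
`isSemisimpleRepresentation_iff_isSemisimpleModule_asModule`) and has the order isomorphism
`Subrepresentation ρ ≃o Submodule k[G] ρ.asModule`, but no comparison for a *sub*representation
`S` between the module `S.toRepresentation.asModule` and the submodule `S.asSubmodule`, and no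
conversion between `Representation.Equiv` and `k[G]`-linear isomorphisms of the `asModule`s.
This file supplies exactly that:

* `Subrepresentation.asModuleEquiv S : S.toRepresentation.asModule ≃ₗ[k[G]] S.asSubmodule`
  (identity on vectors);
* `Representation.Equiv.asModuleLinearEquiv`, `Representation.Equiv.ofAsModuleLinearEquiv`;
* consequences: irreducibility and semisimplicity are invariant under equivalence
  (`Representation.isIrreducible_of_equiv`, `isSemisimpleRepresentation_of_equiv`), a
  subrepresentation of a semisimple representation is semisimple
  (`Subrepresentation.isSemisimpleRepresentation_toRepresentation`), a subrepresentation is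
  irreducible iff it is an atom (`isIrreducible_toRepresentation_iff_isAtom`), and a non-zero
  subrepresentation of a semisimple representation contains an irreducible one
  (`Subrepresentation.exists_isIrreducible_le`);
* small lattice facts: `Subrepresentation.isCompl_iff`,
  `Subrepresentation.subtypeIntertwiningMap_injective`.

Declarations live in `namespace Literature.RepresentationTheory.Semisimple` and are named after
the Mathlib structures they concern (`….Representation.*`, `….Subrepresentation.*`), as in the
sibling file `EquivOfCharacter`; nothing is added to Mathlib's own namespaces.
-/

noncomputable section

namespace Literature.RepresentationTheory.Semisimple

open scoped MonoidAlgebra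
open Literature.RepresentationTheory.FiniteGroups

universe u v w w'

variable {k : Type u} [Field k] {G : Type v} [Group G]
  {V : Type w} [AddCommGroup V] [Module k V] {W : Type w'} [AddCommGroup W] [Module k W]

/-! ### Inclusions and complements -/

/-- The inclusion `G`-map of a subrepresentation
(`Literature.RepresentationTheory.FiniteGroups.Subrepresentation.subtypeIntertwiningMap`) is
injective. [folklore] -/
theorem Subrepresentation.subtypeIntertwiningMap_injective {ρ : Representation k G V}
    (S : Subrepresentation ρ) :
    Function.Injective (Subrepresentation.subtypeIntertwiningMap S) := fun _ _ h => Subtype.ext h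

/-- Subrepresentations are complementary iff their underlying submodules are (the lattice
structure on subrepresentations is induced from submodules; one direction is the tree's
`Subrepresentation.isCompl_toSubmodule`). [folklore] -/
theorem Subrepresentation.isCompl_iff {ρ : Representation k G V} {S Q : Subrepresentation ρ} :
    IsCompl S Q ↔ IsCompl S.toSubmodule Q.toSubmodule := by
  refine ⟨Subrepresentation.isCompl_toSubmodule ρ, fun h => ⟨?_, ?_⟩⟩
  · rw [disjoint_iff]
    exact Subrepresentation.toSubmodule_injective (disjoint_iff.mp h.1)
  · rw [codisjoint_iff]
    exact Subrepresentation.toSubmodule_injective (codisjoint_iff.mp h.2)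

/-! ### The `k[G]`-module dictionary for subrepresentations and equivalences -/

/-- For a subrepresentation `S` of `ρ`, the `k[G]`-module `S.toRepresentation.asModule` is the
`k[G]`-submodule `S.asSubmodule` of `ρ.asModule` (the identity on underlying vectors). [folklore] -/
def Subrepresentation.asModuleEquiv {ρ : Representation k G V} (S : Subrepresentation ρ) :
    S.toRepresentation.asModule ≃ₗ[k[G]] S.asSubmodule where
  toFun x := ⟨ρ.asModuleEquiv.symm ((S.toRepresentation.asModuleEquiv x : S.toSubmodule) : V),
    (S.toRepresentation.asModuleEquiv x).2⟩
  invFun y := S.toRepresentation.asModuleEquiv.symm ⟨ρ.asModuleEquiv (y : ρ.asModule), y.2⟩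
  left_inv x := rfl
  right_inv y := rfl
  map_add' x y := rfl
  map_smul' r x := by
    apply Subtype.ext
    change ρ.asModuleEquiv.symm ((S.toRepresentation.asModuleEquiv (r • x) : S.toSubmodule) : V) =
      r • ρ.asModuleEquiv.symm ((S.toRepresentation.asModuleEquiv x : S.toSubmodule) : V)
    induction r using MonoidAlgebra.induction_on with
    | hM g =>
      rw [Representation.asModuleEquiv_map_smul, Representation.asAlgebraHom_of,
        MonoidAlgebra.of_apply, Representation.single_smul, one_smul, LinearEquiv.apply_symm_apply]
      rfl
    | hadd x' y hx hy => simp only [add_smul, map_add, Submodule.coe_add, hx, hy]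
    | hsmul c x' hx => simp only [smul_assoc, map_smul, Submodule.coe_smul, hx]

/-- An equivalence of representations is a `k[G]`-linear isomorphism of the associated
`k[G]`-modules. [folklore] -/
def Representation.Equiv.asModuleLinearEquiv {ρ : Representation k G V} {σ : Representation k G W}
    (e : Representation.Equiv ρ σ) : ρ.asModule ≃ₗ[k[G]] σ.asModule :=
  LinearEquiv.ofBijective
    (Representation.IntertwiningMap.equivLinearMapAsModule ρ σ e.toIntertwiningMap)
    e.toLinearEquiv.bijective

/-- Conversely, a `k[G]`-linear isomorphism of the associated modules is an equivalence of
representations. [folklore] -/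
def Representation.Equiv.ofAsModuleLinearEquiv {ρ : Representation k G V}
    {σ : Representation k G W} (e : ρ.asModule ≃ₗ[k[G]] σ.asModule) : Representation.Equiv ρ σ :=
  Representation.IntertwiningMap.ofBijective
    ((Representation.IntertwiningMap.equivLinearMapAsModule ρ σ).symm e.toLinearMap) e.bijective

/-! ### Transport of irreducibility and semisimplicity -/

/-- Irreducibility is invariant under equivalence. [folklore] -/
theorem Representation.isIrreducible_of_equiv {ρ : Representation k G V} {σ : Representation k G W}
    (e : Representation.Equiv ρ σ) [ρ.IsIrreducible] : σ.IsIrreducible := by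
  rw [Representation.irreducible_iff_isSimpleModule_asModule] at *
  exact IsSimpleModule.congr (Representation.Equiv.asModuleLinearEquiv e).symm

/-- Semisimplicity is invariant under equivalence. [folklore] -/
theorem Representation.isSemisimpleRepresentation_of_equiv {ρ : Representation k G V}
    {σ : Representation k G W} (e : Representation.Equiv ρ σ) [ρ.IsSemisimpleRepresentation] :
    σ.IsSemisimpleRepresentation := by
  rw [Representation.isSemisimpleRepresentation_iff_isSemisimpleModule_asModule] at *
  exact IsSemisimpleModule.congr (Representation.Equiv.asModuleLinearEquiv e).symm

/-- A subrepresentation of a semisimple representation is semisimple. [folklore] -/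
theorem Subrepresentation.isSemisimpleRepresentation_toRepresentation {ρ : Representation k G V}
    [ρ.IsSemisimpleRepresentation] (S : Subrepresentation ρ) :
    S.toRepresentation.IsSemisimpleRepresentation := by
  haveI : IsSemisimpleModule k[G] ρ.asModule :=
    (Representation.isSemisimpleRepresentation_iff_isSemisimpleModule_asModule ρ).mp ‹_›
  rw [Representation.isSemisimpleRepresentation_iff_isSemisimpleModule_asModule]
  exact IsSemisimpleModule.congr (Subrepresentation.asModuleEquiv S)

/-- A subrepresentation is irreducible iff the corresponding `k[G]`-submodule is simple.
[folklore] -/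
theorem Subrepresentation.isIrreducible_toRepresentation_iff {ρ : Representation k G V}
    (S : Subrepresentation ρ) :
    S.toRepresentation.IsIrreducible ↔ IsSimpleModule k[G] S.asSubmodule := by
  rw [Representation.irreducible_iff_isSimpleModule_asModule]
  exact (Subrepresentation.asModuleEquiv S).isSimpleModule_iff

/-- A subrepresentation is irreducible iff it is an atom of the lattice of subrepresentations.
[folklore] -/
theorem Subrepresentation.isIrreducible_toRepresentation_iff_isAtom {ρ : Representation k G V}
    (S : Subrepresentation ρ) : S.toRepresentation.IsIrreducible ↔ IsAtom S := by
  rw [Subrepresentation.isIrreducible_toRepresentation_iff, isSimpleModule_iff_isAtom]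
  exact (Subrepresentation.subrepresentationSubmoduleOrderIso (ρ := ρ)).isAtom_iff S

/-- In a semisimple representation every non-zero subrepresentation contains an irreducible
one (Mathlib `IsSemisimpleModule.eq_bot_or_exists_simple_le`). [folklore] -/
theorem Subrepresentation.exists_isIrreducible_le {ρ : Representation k G V}
    [ρ.IsSemisimpleRepresentation] (Q : Subrepresentation ρ) (hQ : Q ≠ ⊥) :
    ∃ S : Subrepresentation ρ, S ≤ Q ∧ S.toRepresentation.IsIrreducible := by
  haveI : IsSemisimpleModule k[G] ρ.asModule :=
    (Representation.isSemisimpleRepresentation_iff_isSemisimpleModule_asModule ρ).mp ‹_›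
  rcases IsSemisimpleModule.eq_bot_or_exists_simple_le (R := k[G]) Q.asSubmodule with h | ⟨N, hN, hNs⟩
  · exact absurd (Subrepresentation.subrepresentationSubmoduleOrderIso.injective
      (h.trans (map_bot Subrepresentation.subrepresentationSubmoduleOrderIso).symm)) hQ
  · refine ⟨Subrepresentation.ofSubmodule' N, hN, ?_⟩
    rw [Subrepresentation.isIrreducible_toRepresentation_iff]
    exact hNs

end Literature.RepresentationTheory.Semisimple
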